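import Mathlib.Data.Matrix.Block
import Mathlib.LinearAlgebra.Matrix.Trace
import Mathlib.LinearAlgebra.Matrix.Notation
import Mathlib.LinearAlgebra.Matrix.Determinant.Basic
import Mathlib.LinearAlgebra.Matrix.ToLinearEquiv
import Mathlib.LinearAlgebra.Matrix.NonsingularInverse
import Mathlib.FieldTheory.IsAlgClosed.Basic
import Mathlib.Analysis.Complex.Polynomial.Basic
import Mathlib.LinearAlgebra.Span.Basic
import HarnessLib

/-!
# The `Θ`-subalgebra theorem for unitary multiplicities `(2,2)`, matrix core: an irreducible bracket-closed `𝔐 ⊆ 𝔰𝔩₄(ℂ) ∋ Θ` with `Θ`-eigenspaces of dimensions `2, 2` and NO invariant bilinear form is `𝔰𝔩₄(ℂ)` (the Lie step «`Hg = SU(V,ψ)`» for simple abelian fourfolds of type IV(1,1) with multiplicities `(2,2)`, Moonen–Zarhin 1995; classification-free)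

Family `hodge`, layer `Literature/AlgebraicGeometry/Motives` (pure complex linear algebra of `(2+2) × (2+2)` block
matrices; no geometry). Research context: cell `pub-hodge-ring2` (HONEST FRAMING: research route conditional on
HC_CM; not a corollary; Q11.4-sentence-2 already refuted in dim ≥ 3), Literature lane gen 68, programme R45 = the Lie
step of heir item (H1), sub-row «type IV(1,1), signature (2,2)» of the Moonen–Zarhin 1995 row-four residual.
UNCONDITIONAL; theorems only — no definition, no named fact (D-0026), no `sorry`. The `(2,2)` companion of the tree's
`HodgeThetaSubalgebraUnitaryCoprimeCore` (`(2,3)`, lit g66): there `dim Q = dim P + 1` produced a rank-one idempotent;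
here `dim Q = dim P` and the two PROPER irreducible `Θ`-configurations `𝔰𝔬₄ = 𝔰𝔩₂ ⊗ 1 + 1 ⊗ 𝔰𝔩₂` and `𝔰𝔭₄` do occur
— they are exactly the ones preserving a bilinear form, which is what the extra hypothesis excludes.

THE PRINT. B. Moonen, Yu. Zarhin, Math. Ann. 315 (1999) §2 (2.5) (held `paper:arxiv-math_9901113` p0005 L136–L155):
«For g = 4 we find cases where in addition to divisor classes we also need Weil classes to generate the Hodge ring.
This happens if End⁰(X) contains an imaginary quadratic field k which acts on the tangent space with multiplicities
(2,2) … it can occur only for X of Type 4(1,1) or of Type 4(4,1)», referring to B. Moonen, Yu. Zarhin, *Hodge classes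
and Tate classes on simple abelian fourfolds*, Duke Math. J. 77 (1995) 553–581 (the Hodge groups of simple abelian
fourfolds; for type IV(1,1) with `End⁰(X) = k` of signature `(2,2)`: `Hg(X) = SU(V,ψ)` and `B•(X) = D•(X) + W_k`;
cite-only here, acq-04933). B. van Geemen, LNM 1594 (1994) Thm. 6.11 («the special Mumford–Tate group of a general
abelian variety of Weil type is SU_H») and Thm. 6.12. The classical proofs go through the classification of
representations with two weights (Deligne, Serre, Zarhin); the present file is classification-free.

SETTING (matrices). Index type `Fin 2 ⊕ Fin 2` (the basis `p₁, p₂` of `P = {Θ = 1}` followed by `q_i = C p_i` of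
`Q = {Θ = −1}`); `𝔐` a `ℂ`-subspace of `Matrix (Fin 2 ⊕ Fin 2) (Fin 2 ⊕ Fin 2) ℂ` closed under the commutator and
consisting of traceless matrices, containing `Θ = fromBlocks 1 0 0 (−1)`, the lowering operator
`C = fromBlocks 0 0 1 0` and SOME raising operator `fromBlocks 0 β₀ 0 0` with `β₀` invertible (in the application both
come from the tree's `UnitaryThetaCore.exists_lower_injOn`, applied to `Θ` and to `−Θ`); `𝔐` acts irreducibly on `ℂ⁴`;
and no non-zero matrix `G` satisfies `Xᵀ G + G X = 0` for all `X ∈ 𝔐` (no `𝔐`-invariant bilinear form — in the Hodge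
application: `End_Hdg(V) = k`, so `V_σ ≄ V_σ^* ≅ V_σ̄`).

WHAT IS PROVED.
* §1 `2 × 2` identities: Cayley–Hamilton (private), `xᵀJ = −Jx` and `ab + ba = tr(ab)·1`
  for traceless `x, a, b` (`J = !![0,1;-1,0]`), `AᵀJ + JA = tr(A)·J`, eigenvectors, kernels of non-zero `2 × 2` matrices,
  commuting traceless matrices are proportional.
* §2 the `Θ`-grading in block form (`UnitaryThetaTwoTwo.blocks_mem`: the raising block `fromBlocks 0 β 0 0`, the lowering
  block and the diagonal block of every `X ∈ 𝔐` lie in `𝔐`) and the bracket relations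
  (`diag_mul_mem`: `fromBlocks (βγ) 0 0 (−γβ) ∈ 𝔐`; `raise_comm_mem`: `Aβ − βD`; `lower_comm_mem`: `Dγ − γA`).
* §3 `UnitaryThetaTwoTwo.raise_one_mem` (`1 ∈ S₊` by Cayley–Hamilton from the invertible `β₀`), `lower_of_raise` /
  `raise_of_lower` (`S₊ = S₋ =: S`), `diag_decomp` (every diagonal element is `(σ/2 + M, −σ/2 + M)` with `σ ∈ S` and
  `(M, M) ∈ 𝔐`; `trace_eq_zero_of_twin`: `tr M = 0`; `[M, S] ⊆ S` by `raise_comm_mem`).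
* §4 `UnitaryThetaTwoTwo.mem_of_raise_top` — the generic case: if every `β` is a raising block then every traceless
  matrix lies in `𝔐`.
* §5 the tools for the three degenerate cases: `UnitaryThetaTwoTwo.form_eq_zero` (the form `fromBlocks 0 Γ (−Γ) 0` is
  invariant as soon as the raising blocks are `Γ`-self-adjoint and the twins `Γ`-skew — used with `Γ = J`, the
  SYMMETRIC form of `𝔰𝔬₄` when `S = ℂ1`, and with `Γ = Jn`, the ALTERNATING form of `𝔰𝔭₄` when `S = ℂ1 ⊕ ℂs ⊕ ℂt`,
  `n = [s,t]` semisimple), `not_irreducible_of_eigenline` (a line `ℂk ⊂ ℂ²` preserved by the raising blocks and the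
  twins gives the stable plane `(ℂk, ℂk)` — used with an eigenline of `s` when `S = ℂ1 ⊕ ℂs`, and with `ker n` when
  `n` is nilpotent), `comm_bracket_eq_smul` (Jacobi: `[M, n] = λn`; then `λ·tr(n²) = tr([M,n]n) = 0`).
* §6 **`UnitaryThetaTwoTwo.mem_of_trace_eq_zero`** — THE MATRIX CORE THEOREM: under the hypotheses of the SETTING, every
  traceless matrix lies in `𝔐`.
SEQUEL (not in this file): transport to an abstract `𝔊 ⊆ End(W)` through a basis adapted to `Θ` and `C`
(`UnitaryThetaCore.exists_lower_injOn` twice), then the descent of `HodgeThetaSubalgebraUnitary` to `Lie Hg ⊗ ℂ` of a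
weight-one Hodge structure of rank `8` with `End_Hdg = k` of signature `(2,2)` (the invariant form is excluded by the
commutant theorem `mem_span_endAlg_of_forall_commute`), and the invariant theory of `SU(2,2)` on `⋀⁴`
(`VanGeemen1994.WeilTypeHodgeRingOfSU`).

## References
* [MoonenZarhin1999LowDim] B. Moonen, Yu. Zarhin, Math. Ann. 315 (1999), §2 (2.5) (1)–(2) and Thm. (2.7).
* [MoonenZarhin1995Duke] B. Moonen, Yu. Zarhin, Duke Math. J. 77 (1995) 553–581, main theorem (type IV(1,1), (2,2)).
* [vanGeemen1994HodgeAV] B. van Geemen, LNM 1594 (1994), Thm. 6.11, Thm. 6.12, Lemma 6.10.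
* [Ribet1983] K. A. Ribet, Amer. J. Math. 105 (1983), Thm. 3 (the `Θ`-grading method).
* [Gordon1997] B. B. Gordon, *A survey of the Hodge conjecture for abelian varieties*, Thm. 6.3.3 and pp. 18–19.
* [GoodmanWallachGTM255] R. Goodman, N. Wallach, *Symmetry, Representations, and Invariants*, §4.1.1 (gradings).
-/

noncomputable section

open Matrix

namespace Literature.AlgebraicGeometry.Motives

namespace HodgeStructure

/-! ### §1 Identities for `2 × 2` complex matrices -/

section TwoByTwo

/-- Cayley–Hamilton for `2 × 2` matrices: `A² = tr(A)·A − det(A)·1` (private copy; the tree's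
`ComplexLorentz.two_mul_self_eq` in `MathematicalPhysics/QuantumLattice` states the same identity). [folklore] -/
private theorem UnitaryThetaTwoTwo.mul_self_fin_two (A : Matrix (Fin 2) (Fin 2) ℂ) :
    A * A = A.trace • A - A.det • (1 : Matrix (Fin 2) (Fin 2) ℂ) := by
  ext i j
  rw [trace_fin_two, det_fin_two]
  fin_cases i <;> fin_cases j <;> simp [Matrix.mul_apply, Fin.sum_univ_two] <;> ring

/-- For traceless `2 × 2` matrices `a, b`: `ab + ba = tr(ab)·1` (polarised Cayley–Hamilton). [cite: GoodmanWallachGTM255, §4.1.1] -/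
theorem UnitaryThetaTwoTwo.mul_add_mul_of_trace_eq_zero {a b : Matrix (Fin 2) (Fin 2) ℂ} (ha : a.trace = 0)
    (hb : b.trace = 0) : a * b + b * a = (a * b).trace • (1 : Matrix (Fin 2) (Fin 2) ℂ) := by
  rw [trace_fin_two] at ha hb
  ext i j
  rw [trace_fin_two]
  have ha' : a 1 1 = -a 0 0 := by linear_combination ha
  have hb' : b 1 1 = -b 0 0 := by linear_combination hb
  fin_cases i <;> fin_cases j <;> simp [Matrix.mul_apply, Fin.sum_univ_two, ha', hb'] <;> ring

/-- For a traceless `2 × 2` matrix `x`: `xᵀ J = −J x` with `J = !![0,1;-1,0]` (`J⁻¹xᵀJ = adj(x) = −x`).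
[cite: GoodmanWallachGTM255, §4.1.1] -/
theorem UnitaryThetaTwoTwo.transpose_mul_J_of_trace_eq_zero {x : Matrix (Fin 2) (Fin 2) ℂ} (hx : x.trace = 0) :
    xᵀ * !![(0 : ℂ), 1; -1, 0] = -(!![(0 : ℂ), 1; -1, 0] * x) := by
  rw [trace_fin_two] at hx
  have hx' : x 1 1 = -x 0 0 := by linear_combination hx
  ext i j
  fin_cases i <;> fin_cases j <;> simp [Matrix.mul_apply, Fin.sum_univ_two, hx', Matrix.vecMul, dotProduct]

/-- For every `2 × 2` matrix `A`: `AᵀJ + JA = tr(A)·J`. [cite: GoodmanWallachGTM255, §4.1.1] -/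
theorem UnitaryThetaTwoTwo.transpose_mul_J_add (A : Matrix (Fin 2) (Fin 2) ℂ) :
    Aᵀ * !![(0 : ℂ), 1; -1, 0] + !![(0 : ℂ), 1; -1, 0] * A = A.trace • !![(0 : ℂ), 1; -1, 0] := by
  ext i j
  rw [trace_fin_two]
  fin_cases i <;> fin_cases j <;> simp [Matrix.mul_apply, Fin.sum_univ_two, Matrix.vecMul, dotProduct]

/-- `J = !![0,1;-1,0]` times a non-zero matrix is non-zero. [folklore] -/
private theorem UnitaryThetaTwoTwo.J_mul_ne_zero {n : Matrix (Fin 2) (Fin 2) ℂ} (hn : n ≠ 0) :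
    !![(0 : ℂ), 1; -1, 0] * n ≠ 0 := by
  intro h
  apply hn
  have h00 := congr_fun (congr_fun h 0) 0
  have h01 := congr_fun (congr_fun h 0) 1
  have h10 := congr_fun (congr_fun h 1) 0
  have h11 := congr_fun (congr_fun h 1) 1
  simp [Matrix.mul_apply, Fin.sum_univ_two] at h00 h01 h10 h11
  ext i j
  fin_cases i <;> fin_cases j <;> simp [h00, h01, h10, h11]

/-- `J n` is symmetric for a traceless `2 × 2` matrix `n`. [cite: GoodmanWallachGTM255, §4.1.1] -/
theorem UnitaryThetaTwoTwo.transpose_J_mul_of_trace_eq_zero {n : Matrix (Fin 2) (Fin 2) ℂ} (hn : n.trace = 0) :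
    (!![(0 : ℂ), 1; -1, 0] * n)ᵀ = !![(0 : ℂ), 1; -1, 0] * n := by
  rw [trace_fin_two] at hn
  have hn' : n 1 1 = -n 0 0 := by linear_combination hn
  ext i j
  fin_cases i <;> fin_cases j <;> simp [Matrix.mul_apply, Fin.sum_univ_two, hn', Matrix.vecMul, dotProduct]

/-- Every complex `2 × 2` matrix has an eigenvector. [folklore] -/
private theorem UnitaryThetaTwoTwo.exists_eigenvector_fin_two (s : Matrix (Fin 2) (Fin 2) ℂ) :
    ∃ (ν : ℂ) (k : Fin 2 → ℂ), k ≠ 0 ∧ s *ᵥ k = ν • k := by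
  classical
  -- a root `ν` of the characteristic polynomial `ν² − tr(s) ν + det(s)`
  obtain ⟨z, hz⟩ := IsAlgClosed.exists_pow_nat_eq (s.trace ^ 2 - 4 * s.det) two_pos
  set ν : ℂ := (s.trace + z) / 2 with hν
  have hchar : (s - ν • (1 : Matrix (Fin 2) (Fin 2) ℂ)).det = 0 := by
    rw [det_fin_two]
    simp only [Matrix.sub_apply, Matrix.smul_apply, Matrix.one_apply_eq,
      Matrix.one_apply_ne (show (0 : Fin 2) ≠ 1 by decide), Matrix.one_apply_ne (show (1 : Fin 2) ≠ 0 by decide),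
      smul_eq_mul, mul_one, mul_zero, sub_zero]
    rw [trace_fin_two] at hν hz
    rw [det_fin_two] at hz
    have : ν * ν - (s 0 0 + s 1 1) * ν + (s 0 0 * s 1 1 - s 0 1 * s 1 0) = 0 := by
      rw [hν]; linear_combination (1 / 4 : ℂ) * hz
    linear_combination this
  obtain ⟨k, hk0, hk⟩ := Matrix.exists_mulVec_eq_zero_iff.2 hchar
  refine ⟨ν, k, hk0, ?_⟩
  rw [sub_mulVec, smul_mulVec, one_mulVec, sub_eq_zero] at hk
  exact hk

/-- Two vectors of `ℂ²` with vanishing `2 × 2` determinant, the first non-zero, are proportional. [folklore] -/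
private theorem UnitaryThetaTwoTwo.exists_smul_of_det_eq_zero {k k' : Fin 2 → ℂ} (hk : k ≠ 0)
    (h : k 0 * k' 1 - k 1 * k' 0 = 0) : ∃ c : ℂ, k' = c • k := by
  by_cases h0 : k 0 = 0
  · have h1 : k 1 ≠ 0 := by
      intro h1; apply hk; ext i; fin_cases i <;> simp [h0, h1]
    refine ⟨k' 1 / k 1, ?_⟩
    have h' : k' 0 = 0 := by
      rw [h0, zero_mul, zero_sub, neg_eq_zero] at h
      exact (mul_eq_zero.1 h).resolve_left h1
    ext i; fin_cases i
    · simp [h', h0]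
    · simp; field_simp
  · refine ⟨k' 0 / k 0, ?_⟩
    ext i; fin_cases i
    · simp; field_simp
    · simp; field_simp; linear_combination h

/-- The kernel of a non-zero `2 × 2` matrix is at most a line: if `m k = 0 = m k'` with `k ≠ 0` then `k' ∈ ℂk`. [folklore] -/
private theorem UnitaryThetaTwoTwo.exists_smul_of_mulVec_eq_zero {m : Matrix (Fin 2) (Fin 2) ℂ} (hm : m ≠ 0) {k k' : Fin 2 → ℂ}
    (hk : k ≠ 0) (hmk : m *ᵥ k = 0) (hmk' : m *ᵥ k' = 0) : ∃ c : ℂ, k' = c • k := by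
  classical
  refine UnitaryThetaTwoTwo.exists_smul_of_det_eq_zero hk ?_
  by_contra hdet
  apply hm
  -- the matrix with columns `k, k'` is invertible and killed by `m`
  set K : Matrix (Fin 2) (Fin 2) ℂ := Matrix.of fun i j => if j = 0 then k i else k' i with hKdef
  have hKdet : K.det = k 0 * k' 1 - k 1 * k' 0 := by
    rw [det_fin_two, hKdef]; simp; ring
  have hmK : m * K = 0 := by
    ext i j
    have h0 := congr_fun hmk i
    have h1 := congr_fun hmk' i
    simp only [mulVec, dotProduct, Fin.sum_univ_two, Pi.zero_apply] at h0 h1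
    fin_cases j <;> simp [Matrix.mul_apply, Fin.sum_univ_two, hKdef, h0, h1]
  have hKu : IsUnit K.det := isUnit_iff_ne_zero.2 (hKdet ▸ hdet)
  calc m = m * K * K⁻¹ := by rw [Matrix.mul_assoc, Matrix.mul_nonsing_inv _ hKu, Matrix.mul_one]
    _ = 0 := by rw [hmK, Matrix.zero_mul]

/-- An eigenline of a non-scalar `2 × 2` matrix is the whole eigenspace: if `s k = ν k`, `k ≠ 0`, `s ≠ ν·1` and
`(s − ν) k' = 0` then `k' ∈ ℂ k`. [folklore] -/
private theorem UnitaryThetaTwoTwo.exists_smul_of_eigen {s : Matrix (Fin 2) (Fin 2) ℂ} {ν : ℂ} {k k' : Fin 2 → ℂ} (hk : k ≠ 0)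
    (hsk : s *ᵥ k = ν • k) (hs : s ≠ ν • (1 : Matrix (Fin 2) (Fin 2) ℂ))
    (hk' : (s - ν • (1 : Matrix (Fin 2) (Fin 2) ℂ)) *ᵥ k' = 0) : ∃ c : ℂ, k' = c • k := by
  refine UnitaryThetaTwoTwo.exists_smul_of_mulVec_eq_zero (sub_ne_zero.2 hs) hk ?_ hk'
  rw [sub_mulVec, smul_mulVec, one_mulVec, hsk, sub_self]

/-- Two commuting traceless `2 × 2` matrices, the first non-zero, are proportional (the centraliser of a non-zero
element of `𝔰𝔩₂` is a line). [cite: GoodmanWallachGTM255, §4.1.1] -/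
theorem UnitaryThetaTwoTwo.exists_smul_of_commute {s t : Matrix (Fin 2) (Fin 2) ℂ} (hs : s ≠ 0) (hs0 : s.trace = 0)
    (ht0 : t.trace = 0) (hc : s * t = t * s) : ∃ c : ℂ, t = c • s := by
  rw [trace_fin_two] at hs0 ht0
  have e00 := congr_fun (congr_fun hc 0) 0
  have e01 := congr_fun (congr_fun hc 0) 1
  have e10 := congr_fun (congr_fun hc 1) 0
  simp only [Matrix.mul_apply, Fin.sum_univ_two] at e00 e01 e10
  have hs11 : s 1 1 = -s 0 0 := by linear_combination hs0
  have ht11 : t 1 1 = -t 0 0 := by linear_combination ht0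
  rw [hs11, ht11] at e01 e10
  -- the cross product of `(s₀₀, s₀₁, s₁₀)` and `(t₀₀, t₀₁, t₁₀)` vanishes
  have c1 : s 0 1 * t 1 0 - s 1 0 * t 0 1 = 0 := by linear_combination e00
  have c2 : s 0 0 * t 0 1 - s 0 1 * t 0 0 = 0 := by linear_combination (1 / 2 : ℂ) * e01
  have c3 : s 1 0 * t 0 0 - s 0 0 * t 1 0 = 0 := by linear_combination (1 / 2 : ℂ) * e10
  by_cases h00 : s 0 0 = 0
  · by_cases h01 : s 0 1 = 0
    · have h10 : s 1 0 ≠ 0 := by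
        intro h10; apply hs; ext i j; fin_cases i <;> fin_cases j <;> simp [h00, h01, h10, hs11]
      refine ⟨t 1 0 / s 1 0, ?_⟩
      have ht00 : t 0 0 = 0 := by
        rw [h00] at c3; simp only [zero_mul, sub_zero] at c3
        exact (mul_eq_zero.1 c3).resolve_left h10
      have ht01 : t 0 1 = 0 := by
        rw [h01] at c1; simp only [zero_mul, zero_sub, neg_eq_zero] at c1
        exact (mul_eq_zero.1 c1).resolve_left h10
      ext i j; fin_cases i <;> fin_cases j
      · simp [ht00, h00]
      · simp [ht01, h01]
      · simp; field_simp
      · simp [hs11, ht11, ht00, h00]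
    · refine ⟨t 0 1 / s 0 1, ?_⟩
      have ht00 : t 0 0 = 0 := by
        rw [h00] at c2; simp only [zero_mul, zero_sub, neg_eq_zero] at c2
        exact (mul_eq_zero.1 c2).resolve_left h01
      ext i j; fin_cases i <;> fin_cases j
      · simp [ht00, h00]
      · simp; field_simp
      · simp; field_simp; linear_combination c1
      · simp [hs11, ht11, ht00, h00]
  · refine ⟨t 0 0 / s 0 0, ?_⟩
    ext i j; fin_cases i <;> fin_cases j
    · simp; field_simp
    · simp; field_simp; linear_combination c2
    · simp; field_simp; linear_combination -c3
    · simp [hs11, ht11]; field_simp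

/-- The trace of a block matrix. [folklore] -/
private theorem UnitaryThetaTwoTwo.trace_fromBlocks (A B C D : Matrix (Fin 2) (Fin 2) ℂ) :
    (Matrix.fromBlocks A B C D).trace = A.trace + D.trace := by
  simp [Matrix.trace, Fintype.sum_sum_type, Matrix.fromBlocks]

end TwoByTwo

/-! ### §2 The `Θ`-grading in block form and the bracket relations -/

section Blocks

variable {𝔐 : Submodule ℂ (Matrix (Fin 2 ⊕ Fin 2) (Fin 2 ⊕ Fin 2) ℂ)}

/-- Subtraction of block matrices. [folklore] -/
private theorem UnitaryThetaTwoTwo.fromBlocks_sub (A B C D A' B' C' D' : Matrix (Fin 2) (Fin 2) ℂ) :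
    Matrix.fromBlocks A B C D - Matrix.fromBlocks A' B' C' D' =
      Matrix.fromBlocks (A - A') (B - B') (C - C') (D - D') := by
  ext i j
  rcases i with i | i <;> rcases j with j | j <;> rfl

/-- The commutator with `Θ = fromBlocks 1 0 0 (−1)` doubles the raising block and negates-doubles the lowering
block. [cite: GoodmanWallachGTM255, §4.1.1] -/
theorem UnitaryThetaTwoTwo.theta_comm (A β γ D : Matrix (Fin 2) (Fin 2) ℂ) :
    Matrix.fromBlocks 1 0 0 (-1) * Matrix.fromBlocks A β γ D - Matrix.fromBlocks A β γ D * Matrix.fromBlocks 1 0 0 (-1) =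
      Matrix.fromBlocks 0 ((2 : ℂ) • β) (-((2 : ℂ) • γ)) 0 := by
  rw [fromBlocks_multiply, fromBlocks_multiply, UnitaryThetaTwoTwo.fromBlocks_sub]
  congr 1
  · simp
  · simp [two_smul]
  · simp [two_smul]; abel
  · simp

/-- **The `Θ`-grading in block form**: the raising block `fromBlocks 0 β 0 0`, the lowering block
`fromBlocks 0 0 γ 0` and the diagonal block `fromBlocks A 0 0 D` of every `X = fromBlocks A β γ D ∈ 𝔐` lie in `𝔐`
(`Θ ∈ 𝔐`, `𝔐` bracket-closed: `X₊ = ([Θ,[Θ,X]] + 2[Θ,X])/8`, `X₋ = ([Θ,[Θ,X]] − 2[Θ,X])/8`, `X₀ = X − X₊ − X₋`).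
[cite: GoodmanWallachGTM255, §4.1.1] [cite: Gordon1997, §6 (proof of Thm. 6.3.3)] -/
theorem UnitaryThetaTwoTwo.blocks_mem (hbr : ∀ X ∈ 𝔐, ∀ Y ∈ 𝔐, X * Y - Y * X ∈ 𝔐)
    (hΘ : Matrix.fromBlocks 1 0 0 (-1) ∈ 𝔐) {A β γ D : Matrix (Fin 2) (Fin 2) ℂ}
    (hX : Matrix.fromBlocks A β γ D ∈ 𝔐) :
    Matrix.fromBlocks 0 β 0 0 ∈ 𝔐 ∧ Matrix.fromBlocks 0 0 γ 0 ∈ 𝔐 ∧ Matrix.fromBlocks A 0 0 D ∈ 𝔐 := by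
  have h1 : Matrix.fromBlocks 0 ((2 : ℂ) • β) (-((2 : ℂ) • γ)) 0 ∈ 𝔐 := by
    rw [← UnitaryThetaTwoTwo.theta_comm]; exact hbr _ hΘ _ hX
  have h2 : Matrix.fromBlocks 0 ((2 : ℂ) • ((2 : ℂ) • β)) (-((2 : ℂ) • -((2 : ℂ) • γ))) 0 ∈ 𝔐 := by
    rw [← UnitaryThetaTwoTwo.theta_comm 0 ((2 : ℂ) • β) (-((2 : ℂ) • γ)) 0]; exact hbr _ hΘ _ h1
  have hβ : Matrix.fromBlocks 0 β 0 0 ∈ 𝔐 := by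
    have h : Matrix.fromBlocks (0 : Matrix (Fin 2) (Fin 2) ℂ) β 0 0 =
        (8 : ℂ)⁻¹ • (Matrix.fromBlocks 0 ((2 : ℂ) • ((2 : ℂ) • β)) (-((2 : ℂ) • -((2 : ℂ) • γ))) 0 +
          (2 : ℂ) • Matrix.fromBlocks 0 ((2 : ℂ) • β) (-((2 : ℂ) • γ)) 0) := by
      ext i j
      rcases i with i | i <;> rcases j with j | j <;> simp [fromBlocks]
      ring
    rw [h]
    exact Submodule.smul_mem _ _ (Submodule.add_mem _ h2 (Submodule.smul_mem _ _ h1))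
  have hγ : Matrix.fromBlocks 0 0 γ 0 ∈ 𝔐 := by
    have h : Matrix.fromBlocks (0 : Matrix (Fin 2) (Fin 2) ℂ) 0 γ 0 =
        (8 : ℂ)⁻¹ • (Matrix.fromBlocks 0 ((2 : ℂ) • ((2 : ℂ) • β)) (-((2 : ℂ) • -((2 : ℂ) • γ))) 0 -
          (2 : ℂ) • Matrix.fromBlocks 0 ((2 : ℂ) • β) (-((2 : ℂ) • γ)) 0) := by
      ext i j
      rcases i with i | i <;> rcases j with j | j <;> simp [fromBlocks]
      ring
    rw [h]
    exact Submodule.smul_mem _ _ (Submodule.sub_mem _ h2 (Submodule.smul_mem _ _ h1))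
  refine ⟨hβ, hγ, ?_⟩
  have h : Matrix.fromBlocks A 0 0 D = Matrix.fromBlocks A β γ D - Matrix.fromBlocks 0 β 0 0 - Matrix.fromBlocks 0 0 γ 0 := by
    rw [UnitaryThetaTwoTwo.fromBlocks_sub, UnitaryThetaTwoTwo.fromBlocks_sub]; simp
  rw [h]
  exact Submodule.sub_mem _ (Submodule.sub_mem _ hX hβ) hγ

/-- `[raise β, lower γ] = fromBlocks (βγ) 0 0 (−γβ) ∈ 𝔐`. [cite: GoodmanWallachGTM255, §4.1.1] -/
theorem UnitaryThetaTwoTwo.diag_mul_mem (hbr : ∀ X ∈ 𝔐, ∀ Y ∈ 𝔐, X * Y - Y * X ∈ 𝔐)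
    {β γ : Matrix (Fin 2) (Fin 2) ℂ} (hβ : Matrix.fromBlocks 0 β 0 0 ∈ 𝔐) (hγ : Matrix.fromBlocks 0 0 γ 0 ∈ 𝔐) :
    Matrix.fromBlocks (β * γ) 0 0 (-(γ * β)) ∈ 𝔐 := by
  have h := hbr _ hβ _ hγ
  rwa [fromBlocks_multiply, fromBlocks_multiply, UnitaryThetaTwoTwo.fromBlocks_sub, show
    Matrix.fromBlocks (0 * 0 + β * γ - (0 * 0 + 0 * 0)) (0 * 0 + β * 0 - (0 * β + 0 * 0)) (0 * 0 + 0 * γ - (γ * 0 + 0 * 0))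
      (0 * 0 + (0 : Matrix (Fin 2) (Fin 2) ℂ) * 0 - (γ * β + 0 * 0)) = Matrix.fromBlocks (β * γ) 0 0 (-(γ * β)) by simp] at h

/-- `[fromBlocks A 0 0 D, raise β] = raise (Aβ − βD) ∈ 𝔐`. [cite: GoodmanWallachGTM255, §4.1.1] -/
theorem UnitaryThetaTwoTwo.raise_comm_mem (hbr : ∀ X ∈ 𝔐, ∀ Y ∈ 𝔐, X * Y - Y * X ∈ 𝔐)
    {A D β : Matrix (Fin 2) (Fin 2) ℂ} (hAD : Matrix.fromBlocks A 0 0 D ∈ 𝔐) (hβ : Matrix.fromBlocks 0 β 0 0 ∈ 𝔐) :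
    Matrix.fromBlocks 0 (A * β - β * D) 0 0 ∈ 𝔐 := by
  have h := hbr _ hAD _ hβ
  rwa [fromBlocks_multiply, fromBlocks_multiply, UnitaryThetaTwoTwo.fromBlocks_sub, show
    Matrix.fromBlocks (A * 0 + 0 * 0 - (0 * A + β * 0)) (A * β + 0 * 0 - (0 * 0 + β * D)) (0 * 0 + D * 0 - (0 * A + 0 * 0))
      (0 * β + D * 0 - ((0 : Matrix (Fin 2) (Fin 2) ℂ) * 0 + 0 * D)) = Matrix.fromBlocks 0 (A * β - β * D) 0 0 by simp] at h

/-- `[fromBlocks A 0 0 D, lower γ] = lower (Dγ − γA) ∈ 𝔐`. [cite: GoodmanWallachGTM255, §4.1.1] -/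
theorem UnitaryThetaTwoTwo.lower_comm_mem (hbr : ∀ X ∈ 𝔐, ∀ Y ∈ 𝔐, X * Y - Y * X ∈ 𝔐)
    {A D γ : Matrix (Fin 2) (Fin 2) ℂ} (hAD : Matrix.fromBlocks A 0 0 D ∈ 𝔐) (hγ : Matrix.fromBlocks 0 0 γ 0 ∈ 𝔐) :
    Matrix.fromBlocks 0 0 (D * γ - γ * A) 0 ∈ 𝔐 := by
  have h := hbr _ hAD _ hγ
  rwa [fromBlocks_multiply, fromBlocks_multiply, UnitaryThetaTwoTwo.fromBlocks_sub, show
    Matrix.fromBlocks (A * 0 + 0 * γ - (0 * A + 0 * 0)) (A * 0 + 0 * 0 - (0 * 0 + 0 * D)) (0 * 0 + D * γ - (γ * A + 0 * 0))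
      (0 * 0 + D * 0 - (γ * 0 + (0 : Matrix (Fin 2) (Fin 2) ℂ) * D)) = Matrix.fromBlocks 0 0 (D * γ - γ * A) 0 by simp] at h

/-- `[fromBlocks A 0 0 D, fromBlocks A' 0 0 D'] = fromBlocks [A,A'] 0 0 [D,D'] ∈ 𝔐`. [cite: GoodmanWallachGTM255, §4.1.1] -/
theorem UnitaryThetaTwoTwo.diag_comm_mem (hbr : ∀ X ∈ 𝔐, ∀ Y ∈ 𝔐, X * Y - Y * X ∈ 𝔐)
    {A D A' D' : Matrix (Fin 2) (Fin 2) ℂ} (hAD : Matrix.fromBlocks A 0 0 D ∈ 𝔐)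
    (hAD' : Matrix.fromBlocks A' 0 0 D' ∈ 𝔐) :
    Matrix.fromBlocks (A * A' - A' * A) 0 0 (D * D' - D' * D) ∈ 𝔐 := by
  have h := hbr _ hAD _ hAD'
  rwa [fromBlocks_multiply, fromBlocks_multiply, UnitaryThetaTwoTwo.fromBlocks_sub, show
    Matrix.fromBlocks (A * A' + 0 * 0 - (A' * A + 0 * 0)) (A * 0 + 0 * D' - (A' * 0 + 0 * D)) (0 * A' + D * 0 - (0 * A + D' * 0))
      (0 * 0 + D * D' - ((0 : Matrix (Fin 2) (Fin 2) ℂ) * 0 + D' * D)) =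
      Matrix.fromBlocks (A * A' - A' * A) 0 0 (D * D' - D' * D) by simp] at h

/-- Linearity of the raising block. [folklore] -/
private theorem UnitaryThetaTwoTwo.raise_smul_mem {β : Matrix (Fin 2) (Fin 2) ℂ} (c : ℂ)
    (hβ : Matrix.fromBlocks 0 β 0 0 ∈ 𝔐) : Matrix.fromBlocks 0 (c • β) 0 0 ∈ 𝔐 := by
  simpa [fromBlocks_smul] using Submodule.smul_mem 𝔐 c hβ

/-- Additivity of raising blocks. [folklore] -/
private theorem UnitaryThetaTwoTwo.raise_add_mem {β β' : Matrix (Fin 2) (Fin 2) ℂ}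
    (hβ : Matrix.fromBlocks 0 β 0 0 ∈ 𝔐) (hβ' : Matrix.fromBlocks 0 β' 0 0 ∈ 𝔐) :
    Matrix.fromBlocks 0 (β + β') 0 0 ∈ 𝔐 := by
  simpa [fromBlocks_add] using Submodule.add_mem 𝔐 hβ hβ'

/-- Subtraction of raising blocks. [folklore] -/
private theorem UnitaryThetaTwoTwo.raise_sub_mem {β β' : Matrix (Fin 2) (Fin 2) ℂ}
    (hβ : Matrix.fromBlocks 0 β 0 0 ∈ 𝔐) (hβ' : Matrix.fromBlocks 0 β' 0 0 ∈ 𝔐) :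
    Matrix.fromBlocks 0 (β - β') 0 0 ∈ 𝔐 := by
  simpa [UnitaryThetaTwoTwo.fromBlocks_sub] using Submodule.sub_mem 𝔐 hβ hβ'

/-- Linearity of the lowering block. [folklore] -/
private theorem UnitaryThetaTwoTwo.lower_smul_mem {γ : Matrix (Fin 2) (Fin 2) ℂ} (c : ℂ)
    (hγ : Matrix.fromBlocks 0 0 γ 0 ∈ 𝔐) : Matrix.fromBlocks 0 0 (c • γ) 0 ∈ 𝔐 := by
  simpa [fromBlocks_smul] using Submodule.smul_mem 𝔐 c hγ

/-- Linearity of the diagonal block. [folklore] -/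
private theorem UnitaryThetaTwoTwo.diag_smul_mem {A D : Matrix (Fin 2) (Fin 2) ℂ} (c : ℂ)
    (h : Matrix.fromBlocks A 0 0 D ∈ 𝔐) : Matrix.fromBlocks (c • A) 0 0 (c • D) ∈ 𝔐 := by
  simpa [fromBlocks_smul] using Submodule.smul_mem 𝔐 c h

/-- Additivity of diagonal blocks. [folklore] -/
private theorem UnitaryThetaTwoTwo.diag_add_mem {A D A' D' : Matrix (Fin 2) (Fin 2) ℂ}
    (h : Matrix.fromBlocks A 0 0 D ∈ 𝔐) (h' : Matrix.fromBlocks A' 0 0 D' ∈ 𝔐) :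
    Matrix.fromBlocks (A + A') 0 0 (D + D') ∈ 𝔐 := by
  simpa [fromBlocks_add] using Submodule.add_mem 𝔐 h h'

/-- Subtraction of diagonal blocks. [folklore] -/
private theorem UnitaryThetaTwoTwo.diag_sub_mem {A D A' D' : Matrix (Fin 2) (Fin 2) ℂ}
    (h : Matrix.fromBlocks A 0 0 D ∈ 𝔐) (h' : Matrix.fromBlocks A' 0 0 D' ∈ 𝔐) :
    Matrix.fromBlocks (A - A') 0 0 (D - D') ∈ 𝔐 := by
  simpa [UnitaryThetaTwoTwo.fromBlocks_sub] using Submodule.sub_mem 𝔐 h h'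

/-! ### §3 `1 ∈ S₊`, `S₊ = S₋`, and the shape of the diagonal part -/

/-- **`1 ∈ S₊`**: with the lowering block `C = fromBlocks 0 0 1 0 ∈ 𝔐` and an INVERTIBLE raising block `β₀`, the
raising block `1` lies in `𝔐`: `[raise β₀, C] = fromBlocks β₀ 0 0 (−β₀)`, whose bracket with `raise β₀` is
`raise (2β₀²)`, and `β₀² = tr(β₀)β₀ − det(β₀)·1` (Cayley–Hamilton). [cite: Ribet1983, Thm. 3] [cite: Gordon1997, §6 (proof of Thm. 6.3.3)] -/
theorem UnitaryThetaTwoTwo.raise_one_mem (hbr : ∀ X ∈ 𝔐, ∀ Y ∈ 𝔐, X * Y - Y * X ∈ 𝔐)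
    (hC : Matrix.fromBlocks 0 0 (1 : Matrix (Fin 2) (Fin 2) ℂ) 0 ∈ 𝔐) {β₀ : Matrix (Fin 2) (Fin 2) ℂ}
    (hβ₀ : Matrix.fromBlocks 0 β₀ 0 0 ∈ 𝔐) (hdet : β₀.det ≠ 0) :
    Matrix.fromBlocks 0 (1 : Matrix (Fin 2) (Fin 2) ℂ) 0 0 ∈ 𝔐 := by
  have h1 : Matrix.fromBlocks (β₀ * 1) 0 0 (-(1 * β₀)) ∈ 𝔐 := UnitaryThetaTwoTwo.diag_mul_mem hbr hβ₀ hC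
  rw [Matrix.mul_one, Matrix.one_mul] at h1
  have h2 : Matrix.fromBlocks 0 (β₀ * β₀ - β₀ * -β₀) 0 0 ∈ 𝔐 := UnitaryThetaTwoTwo.raise_comm_mem hbr h1 hβ₀
  rw [mul_neg, sub_neg_eq_add, UnitaryThetaTwoTwo.mul_self_fin_two] at h2
  -- `(trβ₀•β₀ − detβ₀•1) + (trβ₀•β₀ − detβ₀•1)` together with `β₀` gives `1`
  have h3 : Matrix.fromBlocks 0 ((2 * β₀.trace) • β₀ - (β₀.trace • β₀ - β₀.det • (1 : Matrix (Fin 2) (Fin 2) ℂ) +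
      (β₀.trace • β₀ - β₀.det • (1 : Matrix (Fin 2) (Fin 2) ℂ)))) 0 0 ∈ 𝔐 :=
    UnitaryThetaTwoTwo.raise_sub_mem (UnitaryThetaTwoTwo.raise_smul_mem _ hβ₀) h2
  have h4 : (2 * β₀.trace) • β₀ - (β₀.trace • β₀ - β₀.det • (1 : Matrix (Fin 2) (Fin 2) ℂ) +
      (β₀.trace • β₀ - β₀.det • (1 : Matrix (Fin 2) (Fin 2) ℂ))) = (2 * β₀.det) • (1 : Matrix (Fin 2) (Fin 2) ℂ) := by
    module
  rw [h4] at h3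
  have h5 := UnitaryThetaTwoTwo.raise_smul_mem (2 * β₀.det)⁻¹ h3
  rwa [smul_smul, inv_mul_cancel₀ (mul_ne_zero two_ne_zero hdet), one_smul] at h5

/-- **`S₊ ⊆ S₋`**: a raising block is also a lowering block (`[fromBlocks β 0 0 (−β), C] = lower (−2β)`). [cite: Ribet1983, Thm. 3] -/
theorem UnitaryThetaTwoTwo.lower_of_raise (hbr : ∀ X ∈ 𝔐, ∀ Y ∈ 𝔐, X * Y - Y * X ∈ 𝔐)
    (hC : Matrix.fromBlocks 0 0 (1 : Matrix (Fin 2) (Fin 2) ℂ) 0 ∈ 𝔐) {β : Matrix (Fin 2) (Fin 2) ℂ}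
    (hβ : Matrix.fromBlocks 0 β 0 0 ∈ 𝔐) : Matrix.fromBlocks 0 0 β 0 ∈ 𝔐 := by
  have h1 : Matrix.fromBlocks (β * 1) 0 0 (-(1 * β)) ∈ 𝔐 := UnitaryThetaTwoTwo.diag_mul_mem hbr hβ hC
  rw [Matrix.mul_one, Matrix.one_mul] at h1
  have h2 : Matrix.fromBlocks 0 0 (-β * 1 - 1 * β) 0 ∈ 𝔐 := UnitaryThetaTwoTwo.lower_comm_mem hbr h1 hC
  rw [Matrix.mul_one, Matrix.one_mul, show -β - β = (-2 : ℂ) • β by module] at h2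
  have h3 := UnitaryThetaTwoTwo.lower_smul_mem (-2 : ℂ)⁻¹ h2
  rwa [smul_smul, inv_mul_cancel₀ (by norm_num : (-2 : ℂ) ≠ 0), one_smul] at h3

/-- **`S₋ ⊆ S₊`** (given `1 ∈ S₊`): a lowering block is also a raising block. [cite: Ribet1983, Thm. 3] -/
theorem UnitaryThetaTwoTwo.raise_of_lower (hbr : ∀ X ∈ 𝔐, ∀ Y ∈ 𝔐, X * Y - Y * X ∈ 𝔐)
    (h1 : Matrix.fromBlocks 0 (1 : Matrix (Fin 2) (Fin 2) ℂ) 0 0 ∈ 𝔐) {γ : Matrix (Fin 2) (Fin 2) ℂ}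
    (hγ : Matrix.fromBlocks 0 0 γ 0 ∈ 𝔐) : Matrix.fromBlocks 0 γ 0 0 ∈ 𝔐 := by
  have h2 : Matrix.fromBlocks (1 * γ) 0 0 (-(γ * 1)) ∈ 𝔐 := UnitaryThetaTwoTwo.diag_mul_mem hbr h1 hγ
  rw [Matrix.mul_one, Matrix.one_mul] at h2
  have h3 : Matrix.fromBlocks 0 (γ * 1 - 1 * -γ) 0 0 ∈ 𝔐 := UnitaryThetaTwoTwo.raise_comm_mem hbr h2 h1
  rw [Matrix.mul_one, Matrix.one_mul, sub_neg_eq_add, show γ + γ = (2 : ℂ) • γ by module] at h3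
  have h4 := UnitaryThetaTwoTwo.raise_smul_mem (2 : ℂ)⁻¹ h3
  rwa [smul_smul, inv_mul_cancel₀ (by norm_num : (2 : ℂ) ≠ 0), one_smul] at h4

/-- **The shape of the diagonal part**: if `fromBlocks A 0 0 D ∈ 𝔐` then `σ := A − D` is a raising block and
`fromBlocks M 0 0 M ∈ 𝔐` for `M := (A + D)/2` — so `(A, D) = (σ/2 + M, −σ/2 + M)`. [cite: Ribet1983, Thm. 3]
[cite: GoodmanWallachGTM255, §4.1.1] -/
theorem UnitaryThetaTwoTwo.diag_decomp (hbr : ∀ X ∈ 𝔐, ∀ Y ∈ 𝔐, X * Y - Y * X ∈ 𝔐)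
    (h1 : Matrix.fromBlocks 0 (1 : Matrix (Fin 2) (Fin 2) ℂ) 0 0 ∈ 𝔐)
    (hC : Matrix.fromBlocks 0 0 (1 : Matrix (Fin 2) (Fin 2) ℂ) 0 ∈ 𝔐) {A D : Matrix (Fin 2) (Fin 2) ℂ}
    (hAD : Matrix.fromBlocks A 0 0 D ∈ 𝔐) :
    Matrix.fromBlocks 0 (A - D) 0 0 ∈ 𝔐 ∧
      Matrix.fromBlocks ((2 : ℂ)⁻¹ • (A + D)) 0 0 ((2 : ℂ)⁻¹ • (A + D)) ∈ 𝔐 := by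
  have hσ : Matrix.fromBlocks 0 (A * 1 - 1 * D) 0 0 ∈ 𝔐 := UnitaryThetaTwoTwo.raise_comm_mem hbr hAD h1
  rw [Matrix.mul_one, Matrix.one_mul] at hσ
  refine ⟨hσ, ?_⟩
  have h2 : Matrix.fromBlocks ((A - D) * 1) 0 0 (-(1 * (A - D))) ∈ 𝔐 := UnitaryThetaTwoTwo.diag_mul_mem hbr hσ hC
  rw [Matrix.mul_one, Matrix.one_mul] at h2
  have h3 := UnitaryThetaTwoTwo.diag_sub_mem hAD (UnitaryThetaTwoTwo.diag_smul_mem (2 : ℂ)⁻¹ h2)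
  have eA : A - (2 : ℂ)⁻¹ • (A - D) = (2 : ℂ)⁻¹ • (A + D) := by module
  have eD : D - (2 : ℂ)⁻¹ • -(A - D) = (2 : ℂ)⁻¹ • (A + D) := by module
  rwa [eA, eD] at h3

/-- A «twin» diagonal element `fromBlocks M 0 0 M ∈ 𝔐` is traceless when `𝔐` is. [folklore] -/
private theorem UnitaryThetaTwoTwo.trace_eq_zero_of_twin (hsl : ∀ X ∈ 𝔐, Matrix.trace X = 0)
    {M : Matrix (Fin 2) (Fin 2) ℂ} (hM : Matrix.fromBlocks M 0 0 M ∈ 𝔐) : M.trace = 0 := by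
  have h := hsl _ hM
  rw [UnitaryThetaTwoTwo.trace_fromBlocks, ← two_mul] at h
  exact (mul_eq_zero.1 h).resolve_left two_ne_zero

/-! ### §4 The generic case: every `β` is a raising block -/

/-- If every `2 × 2` matrix is a raising block (and `C ∈ 𝔐`), then `fromBlocks 0 0 0 T ∈ 𝔐` for every traceless `T`
(`[raise E_{ij}, lower E_{kl}]` produce `E₀₁, E₁₀, E₁₁ − E₀₀` in the lower diagonal block). [cite: Ribet1983, Thm. 3] -/
theorem UnitaryThetaTwoTwo.diag_zero_mem_of_raise_top (hbr : ∀ X ∈ 𝔐, ∀ Y ∈ 𝔐, X * Y - Y * X ∈ 𝔐)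
    (hC : Matrix.fromBlocks 0 0 (1 : Matrix (Fin 2) (Fin 2) ℂ) 0 ∈ 𝔐)
    (hall : ∀ β : Matrix (Fin 2) (Fin 2) ℂ, Matrix.fromBlocks 0 β 0 0 ∈ 𝔐) {T : Matrix (Fin 2) (Fin 2) ℂ}
    (hT : T.trace = 0) : Matrix.fromBlocks 0 0 0 T ∈ 𝔐 := by
  have hlow : ∀ γ : Matrix (Fin 2) (Fin 2) ℂ, Matrix.fromBlocks 0 0 γ 0 ∈ 𝔐 :=
    fun γ => UnitaryThetaTwoTwo.lower_of_raise hbr hC (hall γ)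
  have hE01 : Matrix.fromBlocks 0 0 0 (-(!![(0 : ℂ), 1; 0, 0])) ∈ 𝔐 := by
    have h := UnitaryThetaTwoTwo.diag_mul_mem hbr (hall !![(0 : ℂ), 0; 0, 1]) (hlow !![(0 : ℂ), 1; 0, 0])
    have e1 : !![(0 : ℂ), 0; 0, 1] * !![(0 : ℂ), 1; 0, 0] = 0 := by
      ext i j; fin_cases i <;> fin_cases j <;> simp [Matrix.mul_apply, Fin.sum_univ_two]
    have e2 : !![(0 : ℂ), 1; 0, 0] * !![(0 : ℂ), 0; 0, 1] = !![(0 : ℂ), 1; 0, 0] := by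
      ext i j; fin_cases i <;> fin_cases j <;> simp [Matrix.mul_apply, Fin.sum_univ_two]
    rwa [e1, e2] at h
  have hE10 : Matrix.fromBlocks 0 0 0 (-(!![(0 : ℂ), 0; 1, 0])) ∈ 𝔐 := by
    have h := UnitaryThetaTwoTwo.diag_mul_mem hbr (hall !![(1 : ℂ), 0; 0, 0]) (hlow !![(0 : ℂ), 0; 1, 0])
    have e1 : !![(1 : ℂ), 0; 0, 0] * !![(0 : ℂ), 0; 1, 0] = 0 := by
      ext i j; fin_cases i <;> fin_cases j <;> simp [Matrix.mul_apply, Fin.sum_univ_two]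
    have e2 : !![(0 : ℂ), 0; 1, 0] * !![(1 : ℂ), 0; 0, 0] = !![(0 : ℂ), 0; 1, 0] := by
      ext i j; fin_cases i <;> fin_cases j <;> simp [Matrix.mul_apply, Fin.sum_univ_two]
    rwa [e1, e2] at h
  have hH : Matrix.fromBlocks 0 0 0 (!![(1 : ℂ), 0; 0, 0] - !![(0 : ℂ), 0; 0, 1]) ∈ 𝔐 := by
    have h := UnitaryThetaTwoTwo.diag_mul_mem hbr (hall !![(0 : ℂ), 0; 1, 0]) (hlow !![(0 : ℂ), 1; 0, 0])
    have e1 : !![(0 : ℂ), 0; 1, 0] * !![(0 : ℂ), 1; 0, 0] = !![(0 : ℂ), 0; 0, 1] := by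
      ext i j; fin_cases i <;> fin_cases j <;> simp [Matrix.mul_apply, Fin.sum_univ_two]
    have e2 : !![(0 : ℂ), 1; 0, 0] * !![(0 : ℂ), 0; 1, 0] = !![(1 : ℂ), 0; 0, 0] := by
      ext i j; fin_cases i <;> fin_cases j <;> simp [Matrix.mul_apply, Fin.sum_univ_two]
    rw [e1, e2] at h
    have h' : Matrix.fromBlocks (!![(0 : ℂ), 0; 0, 1] * 1) 0 0 (-(1 * !![(0 : ℂ), 0; 0, 1])) ∈ 𝔐 :=
      UnitaryThetaTwoTwo.diag_mul_mem hbr (hall _) hC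
    rw [Matrix.mul_one, Matrix.one_mul] at h'
    have h'' := UnitaryThetaTwoTwo.diag_sub_mem h' h
    rwa [sub_self, show -(!![(0 : ℂ), 0; 0, 1]) - -(!![(1 : ℂ), 0; 0, 0]) = !![(1 : ℂ), 0; 0, 0] - !![(0 : ℂ), 0; 0, 1]
      by abel] at h''
  -- `T = T₀₁ E₀₁ + T₁₀ E₁₀ + T₀₀ (E₀₀ − E₁₁)`
  rw [trace_fin_two] at hT
  have eT : T = (-T 0 1) • (-(!![(0 : ℂ), 1; 0, 0])) + (-T 1 0) • (-(!![(0 : ℂ), 0; 1, 0])) +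
      T 0 0 • (!![(1 : ℂ), 0; 0, 0] - !![(0 : ℂ), 0; 0, 1]) := by
    have hT' : T 1 1 = -T 0 0 := by linear_combination hT
    ext i j; fin_cases i <;> fin_cases j <;> simp [hT']
  have key := UnitaryThetaTwoTwo.diag_add_mem (UnitaryThetaTwoTwo.diag_add_mem
    (UnitaryThetaTwoTwo.diag_smul_mem (-T 0 1) hE01) (UnitaryThetaTwoTwo.diag_smul_mem (-T 1 0) hE10))
    (UnitaryThetaTwoTwo.diag_smul_mem (T 0 0) hH)
  simp only [smul_zero, add_zero] at key
  rwa [← eT] at key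

/-- **The generic case**: if every `2 × 2` matrix is a raising block and `C ∈ 𝔐`, then EVERY traceless matrix lies in
`𝔐` (`𝔐 ⊇ 𝔰𝔩₄`). [cite: Ribet1983, Thm. 3] [cite: Gordon1997, Thm. 6.3.3] -/
theorem UnitaryThetaTwoTwo.mem_of_raise_top (hbr : ∀ X ∈ 𝔐, ∀ Y ∈ 𝔐, X * Y - Y * X ∈ 𝔐)
    (hC : Matrix.fromBlocks 0 0 (1 : Matrix (Fin 2) (Fin 2) ℂ) 0 ∈ 𝔐)
    (hall : ∀ β : Matrix (Fin 2) (Fin 2) ℂ, Matrix.fromBlocks 0 β 0 0 ∈ 𝔐)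
    {Y : Matrix (Fin 2 ⊕ Fin 2) (Fin 2 ⊕ Fin 2) ℂ} (hY : Y.trace = 0) : Y ∈ 𝔐 := by
  rw [← fromBlocks_toBlocks Y] at hY ⊢
  set A := Y.toBlocks₁₁
  set β := Y.toBlocks₁₂
  set γ := Y.toBlocks₂₁
  set D := Y.toBlocks₂₂
  rw [UnitaryThetaTwoTwo.trace_fromBlocks] at hY
  have hdiag : Matrix.fromBlocks A 0 0 D ∈ 𝔐 := by
    have h1 : Matrix.fromBlocks (A * 1) 0 0 (-(1 * A)) ∈ 𝔐 := UnitaryThetaTwoTwo.diag_mul_mem hbr (hall A) hC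
    rw [Matrix.mul_one, Matrix.one_mul] at h1
    have h2 : Matrix.fromBlocks 0 0 0 (A + D) ∈ 𝔐 :=
      UnitaryThetaTwoTwo.diag_zero_mem_of_raise_top hbr hC hall (by rw [Matrix.trace_add, hY])
    have h3 := UnitaryThetaTwoTwo.diag_add_mem h1 h2
    rwa [add_zero, neg_add_cancel_left] at h3
  have e : Matrix.fromBlocks A β γ D =
      Matrix.fromBlocks A 0 0 D + Matrix.fromBlocks 0 β 0 0 + Matrix.fromBlocks 0 0 γ 0 := by
    rw [fromBlocks_add, fromBlocks_add]; simp
  rw [e]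
  exact Submodule.add_mem _ (Submodule.add_mem _ hdiag (hall β)) (UnitaryThetaTwoTwo.lower_of_raise hbr hC (hall γ))

end Blocks

/-! ### §5 The degenerate cases: an invariant form (`𝔰𝔬₄`, `𝔰𝔭₄`) or a stable plane -/

section Degenerate

variable {𝔐 : Submodule ℂ (Matrix (Fin 2 ⊕ Fin 2) (Fin 2 ⊕ Fin 2) ℂ)}

/-- `Θ ∈ 𝔐` from the raising block `1` and `C`: `[raise 1, C] = fromBlocks 1 0 0 (−1)`. [cite: GoodmanWallachGTM255, §4.1.1] -/
theorem UnitaryThetaTwoTwo.theta_mem (hbr : ∀ X ∈ 𝔐, ∀ Y ∈ 𝔐, X * Y - Y * X ∈ 𝔐)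
    (h1 : Matrix.fromBlocks 0 (1 : Matrix (Fin 2) (Fin 2) ℂ) 0 0 ∈ 𝔐)
    (hC : Matrix.fromBlocks 0 0 (1 : Matrix (Fin 2) (Fin 2) ℂ) 0 ∈ 𝔐) :
    Matrix.fromBlocks 1 0 0 (-1) ∈ 𝔐 := by
  simpa using UnitaryThetaTwoTwo.diag_mul_mem hbr h1 hC

/-- **The form `fromBlocks 0 Γ (−Γ) 0` is `𝔐`-invariant** as soon as every raising block `β` is `Γ`-self-adjoint
(`βᵀΓ = Γβ`) and every twin diagonal element `fromBlocks M 0 0 M ∈ 𝔐` is `Γ`-skew (`MᵀΓ + ΓM = 0`); hence, if `𝔐`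
preserves no non-zero bilinear form, `Γ = 0`. (The diagonal part of `X ∈ 𝔐` is `(σ/2 + M, −σ/2 + M)` with `σ` a
raising block, `UnitaryThetaTwoTwo.diag_decomp`.) [cite: vanGeemen1994HodgeAV, 6.9 and Lemma 6.10] [cite: Ribet1983, Thm. 3] -/
theorem UnitaryThetaTwoTwo.form_eq_zero (hbr : ∀ X ∈ 𝔐, ∀ Y ∈ 𝔐, X * Y - Y * X ∈ 𝔐)
    (h1 : Matrix.fromBlocks 0 (1 : Matrix (Fin 2) (Fin 2) ℂ) 0 0 ∈ 𝔐)
    (hC : Matrix.fromBlocks 0 0 (1 : Matrix (Fin 2) (Fin 2) ℂ) 0 ∈ 𝔐)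
    (hND : ∀ G : Matrix (Fin 2 ⊕ Fin 2) (Fin 2 ⊕ Fin 2) ℂ, (∀ X ∈ 𝔐, Xᵀ * G + G * X = 0) → G = 0)
    {Γ : Matrix (Fin 2) (Fin 2) ℂ}
    (hΓβ : ∀ β : Matrix (Fin 2) (Fin 2) ℂ, Matrix.fromBlocks 0 β 0 0 ∈ 𝔐 → βᵀ * Γ = Γ * β)
    (hΓM : ∀ M : Matrix (Fin 2) (Fin 2) ℂ, Matrix.fromBlocks M 0 0 M ∈ 𝔐 → Mᵀ * Γ + Γ * M = 0) : Γ = 0 := by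
  have hΘ := UnitaryThetaTwoTwo.theta_mem hbr h1 hC
  have hG := hND (Matrix.fromBlocks 0 Γ (-Γ) 0) fun X hX => by
    rw [← fromBlocks_toBlocks X] at hX ⊢
    set A := X.toBlocks₁₁
    set β := X.toBlocks₁₂
    set γ := X.toBlocks₂₁
    set D := X.toBlocks₂₂
    obtain ⟨hβ, hγ, hAD⟩ := UnitaryThetaTwoTwo.blocks_mem hbr hΘ hX
    have hγ' := hΓβ γ (UnitaryThetaTwoTwo.raise_of_lower hbr h1 hγ)
    have hβ' := hΓβ β hβ
    obtain ⟨hσ, hM⟩ := UnitaryThetaTwoTwo.diag_decomp hbr h1 hC hAD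
    have hσ' := hΓβ _ hσ
    have hM' := hΓM _ hM
    have hM'' : Aᵀ * Γ + Dᵀ * Γ + Γ * A + Γ * D = 0 := by
      rw [transpose_smul, transpose_add, Matrix.smul_mul, Matrix.mul_smul, ← smul_add, smul_eq_zero] at hM'
      rcases hM' with h | h
      · norm_num at h
      · rw [Matrix.add_mul, Matrix.mul_add] at h
        calc Aᵀ * Γ + Dᵀ * Γ + Γ * A + Γ * D = Aᵀ * Γ + Dᵀ * Γ + (Γ * A + Γ * D) := by abel
          _ = 0 := h
    have hσ'' : Aᵀ * Γ - Dᵀ * Γ = Γ * A - Γ * D := by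
      rw [transpose_sub, Matrix.sub_mul, Matrix.mul_sub] at hσ'; exact hσ'
    have h12 : Aᵀ * Γ + Γ * D = 0 := by
      have e : Aᵀ * Γ + Γ * D =
          (2 : ℂ)⁻¹ • ((Aᵀ * Γ + Dᵀ * Γ + Γ * A + Γ * D) + ((Aᵀ * Γ - Dᵀ * Γ) - (Γ * A - Γ * D))) := by module
      rw [e, hM'', hσ'', sub_self, add_zero, smul_zero]
    have h21 : Dᵀ * Γ + Γ * A = 0 := by
      have e : Dᵀ * Γ + Γ * A =
          (2 : ℂ)⁻¹ • ((Aᵀ * Γ + Dᵀ * Γ + Γ * A + Γ * D) - ((Aᵀ * Γ - Dᵀ * Γ) - (Γ * A - Γ * D))) := by module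
      rw [e, hM'', hσ'', sub_self, sub_zero, smul_zero]
    rw [fromBlocks_transpose, fromBlocks_multiply, fromBlocks_multiply, fromBlocks_add, ← fromBlocks_zero]
    simp only [Matrix.zero_mul, Matrix.mul_zero, zero_add, add_zero, Matrix.mul_neg, Matrix.neg_mul]
    rw [fromBlocks_inj]
    refine ⟨?_, h12, ?_, ?_⟩
    · rw [hγ', neg_add_cancel]
    · rw [← neg_add, h21, neg_zero]
    · rw [hβ', add_neg_cancel]
  have h := congr_arg Matrix.toBlocks₁₂ hG
  rw [toBlocks_fromBlocks₁₂] at h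
  rw [h]; ext i j; rfl

/-- **A common eigenline gives a stable plane**: if `k ≠ 0`, every raising block maps `k` into `ℂk` and so does every
twin diagonal element, then ALL four blocks of every `X ∈ 𝔐` do (lowering blocks are raising blocks; the diagonal part
is `(σ/2 + M, −σ/2 + M)`), so the plane `{(ak, bk)} ⊂ ℂ² ⊕ ℂ²` is `𝔐`-stable, non-zero and proper: `𝔐` is
REDUCIBLE. [cite: Gordon1997, §6 (proof of Thm. 6.3.3, p. 19)] [cite: Ribet1983, Thm. 3] -/
theorem UnitaryThetaTwoTwo.not_irreducible_of_eigenline (hbr : ∀ X ∈ 𝔐, ∀ Y ∈ 𝔐, X * Y - Y * X ∈ 𝔐)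
    (h1 : Matrix.fromBlocks 0 (1 : Matrix (Fin 2) (Fin 2) ℂ) 0 0 ∈ 𝔐)
    (hC : Matrix.fromBlocks 0 0 (1 : Matrix (Fin 2) (Fin 2) ℂ) 0 ∈ 𝔐) {k : Fin 2 → ℂ} (hk : k ≠ 0)
    (hS : ∀ β : Matrix (Fin 2) (Fin 2) ℂ, Matrix.fromBlocks 0 β 0 0 ∈ 𝔐 → ∃ c : ℂ, β *ᵥ k = c • k)
    (hM : ∀ M : Matrix (Fin 2) (Fin 2) ℂ, Matrix.fromBlocks M 0 0 M ∈ 𝔐 → ∃ c : ℂ, M *ᵥ k = c • k) :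
    ¬ ∀ U : Submodule ℂ (Fin 2 ⊕ Fin 2 → ℂ), (∀ X ∈ 𝔐, ∀ v ∈ U, X *ᵥ v ∈ U) → U = ⊥ ∨ U = ⊤ := by
  intro hirr
  have hΘ := UnitaryThetaTwoTwo.theta_mem hbr h1 hC
  set U : Submodule ℂ (Fin 2 ⊕ Fin 2 → ℂ) := Submodule.span ℂ {Sum.elim k (0 : Fin 2 → ℂ), Sum.elim (0 : Fin 2 → ℂ) k} with hUdef
  have hUmem : ∀ a b : ℂ, Sum.elim (a • k) (b • k) ∈ U := fun a b => by
    rw [hUdef, Submodule.mem_span_pair]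
    refine ⟨a, b, ?_⟩
    ext i; rcases i with i | i <;> simp
  -- stability
  have hstab : ∀ X ∈ 𝔐, ∀ v ∈ U, X *ᵥ v ∈ U := by
    intro X hX v hv
    rw [hUdef, Submodule.mem_span_pair] at hv
    obtain ⟨a, b, rfl⟩ := hv
    rw [← fromBlocks_toBlocks X] at hX ⊢
    set A := X.toBlocks₁₁
    set β := X.toBlocks₁₂
    set γ := X.toBlocks₂₁
    set D := X.toBlocks₂₂
    obtain ⟨hβ, hγ, hAD⟩ := UnitaryThetaTwoTwo.blocks_mem hbr hΘ hX
    obtain ⟨cβ, hcβ⟩ := hS β hβ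
    obtain ⟨cγ, hcγ⟩ := hS γ (UnitaryThetaTwoTwo.raise_of_lower hbr h1 hγ)
    obtain ⟨hσ, hMm⟩ := UnitaryThetaTwoTwo.diag_decomp hbr h1 hC hAD
    obtain ⟨cσ, hcσ⟩ := hS _ hσ
    obtain ⟨cM, hcM⟩ := hM _ hMm
    have eA : A = (2 : ℂ)⁻¹ • (A + D) + (2 : ℂ)⁻¹ • (A - D) := by module
    have eD : D = (2 : ℂ)⁻¹ • (A + D) - (2 : ℂ)⁻¹ • (A - D) := by module
    have hAk : A *ᵥ k = (cM + (2 : ℂ)⁻¹ * cσ) • k := by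
      rw [eA, add_mulVec, hcM, smul_mulVec, hcσ, smul_smul, ← add_smul]
    have hDk : D *ᵥ k = (cM - (2 : ℂ)⁻¹ * cσ) • k := by
      rw [eD, sub_mulVec, hcM, smul_mulVec, hcσ, smul_smul, ← sub_smul]
    have hv : a • (Sum.elim k (0 : Fin 2 → ℂ)) + b • Sum.elim (0 : Fin 2 → ℂ) k = Sum.elim (a • k) (b • k) := by
      ext i; rcases i with i | i <;> simp
    rw [hv, fromBlocks_mulVec]
    have e1 : (Sum.elim (a • k) (b • k) : Fin 2 ⊕ Fin 2 → ℂ) ∘ Sum.inl = a • k := rfl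
    have e2 : (Sum.elim (a • k) (b • k) : Fin 2 ⊕ Fin 2 → ℂ) ∘ Sum.inr = b • k := rfl
    rw [e1, e2, mulVec_smul, mulVec_smul, mulVec_smul, mulVec_smul, hAk, hcβ, hcγ, hDk, smul_smul, smul_smul,
      smul_smul, smul_smul, ← add_smul, ← add_smul]
    exact hUmem _ _
  rcases hirr U hstab with hbot | htop
  · -- `U ≠ ⊥`
    have hmem : (Sum.elim k (0 : Fin 2 → ℂ)) ∈ U := by simpa using hUmem 1 0
    rw [hbot, Submodule.mem_bot] at hmem
    apply hk
    ext i
    simpa using congr_fun hmem (Sum.inl i)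
  · -- `U ≠ ⊤`: both `(e₀, 0)` and `(e₁, 0)` would lie on the line `(ℂk, ℂk)`
    have hline : ∀ k' : Fin 2 → ℂ, ∃ a : ℂ, k' = a • k := by
      intro k'
      have hmem : (Sum.elim k' (0 : Fin 2 → ℂ)) ∈ U := by rw [htop]; exact Submodule.mem_top
      rw [hUdef, Submodule.mem_span_pair] at hmem
      obtain ⟨a, b, hab⟩ := hmem
      refine ⟨a, ?_⟩
      ext i
      have := congr_fun hab (Sum.inl i)
      simpa using this.symm
    obtain ⟨a₀, ha₀⟩ := hline (Pi.single 0 1)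
    obtain ⟨a₁, ha₁⟩ := hline (Pi.single 1 1)
    -- `a₀ k₀ = 1`, `a₀ k₁ = 0`, `a₁ k₀ = 0`, `a₁ k₁ = 1`
    have e00 : a₀ * k 0 = 1 := by simpa using (congr_fun ha₀ 0).symm
    have e01 : a₀ * k 1 = 0 := by simpa using (congr_fun ha₀ 1).symm
    have e10 : a₁ * k 0 = 0 := by simpa using (congr_fun ha₁ 0).symm
    have e11 : a₁ * k 1 = 1 := by simpa using (congr_fun ha₁ 1).symm
    have ha₀0 : a₀ ≠ 0 := by rintro rfl; rw [zero_mul] at e00; exact zero_ne_one e00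
    have ha₁0 : a₁ ≠ 0 := by rintro rfl; rw [zero_mul] at e11; exact zero_ne_one e11
    have hk1 : k 1 = 0 := (mul_eq_zero.1 e01).resolve_left ha₀0
    have hk0 : k 0 = 0 := (mul_eq_zero.1 e10).resolve_left ha₁0
    rw [hk0, mul_zero] at e00
    exact zero_ne_one e00

/-- **Jacobi**: if `[M, s] = a·1 + b·s + c·t` and `[M, t] = a'·1 + b'·s + c'·t` then `[M, [s,t]] = (b + c')·[s,t]`.
[cite: GoodmanWallachGTM255, §4.1.1] -/
theorem UnitaryThetaTwoTwo.comm_bracket_eq_smul {M s t : Matrix (Fin 2) (Fin 2) ℂ} {a b c a' b' c' : ℂ}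
    (hs : M * s - s * M = a • (1 : Matrix (Fin 2) (Fin 2) ℂ) + b • s + c • t)
    (ht : M * t - t * M = a' • (1 : Matrix (Fin 2) (Fin 2) ℂ) + b' • s + c' • t) :
    M * (s * t - t * s) - (s * t - t * s) * M = (b + c') • (s * t - t * s) := by
  have e : M * (s * t - t * s) - (s * t - t * s) * M =
      (M * s - s * M) * t - t * (M * s - s * M) + (s * (M * t - t * M) - (M * t - t * M) * s) := by
    noncomm_ring
  rw [e, hs, ht]
  simp only [Matrix.add_mul, Matrix.mul_add, Matrix.smul_mul, Matrix.mul_smul, Matrix.one_mul, Matrix.mul_one]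
  module

/-- `tr([M,n]·n) = 0`. [folklore] -/
private theorem UnitaryThetaTwoTwo.trace_comm_mul_self (M n : Matrix (Fin 2) (Fin 2) ℂ) :
    ((M * n - n * M) * n).trace = 0 := by
  rw [Matrix.sub_mul, trace_sub, sub_eq_zero, trace_mul_comm (M * n) n, ← Matrix.mul_assoc]

/-- `tr(s·[s,t]) = 0` and `tr(t·[s,t]) = 0`. [folklore] -/
private theorem UnitaryThetaTwoTwo.trace_mul_comm_left (s t : Matrix (Fin 2) (Fin 2) ℂ) :
    (s * (s * t - t * s)).trace = 0 ∧ (t * (s * t - t * s)).trace = 0 := by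
  constructor
  · rw [Matrix.mul_sub, trace_sub, sub_eq_zero, ← Matrix.mul_assoc, trace_mul_comm (s * s) t,
      trace_mul_comm s (t * s), ← Matrix.mul_assoc]
  · rw [Matrix.mul_sub, trace_sub, sub_eq_zero, ← Matrix.mul_assoc, trace_mul_comm t (t * s)]

end Degenerate

/-! ### §6 The matrix core theorem -/

section Main

variable {𝔐 : Submodule ℂ (Matrix (Fin 2 ⊕ Fin 2) (Fin 2 ⊕ Fin 2) ℂ)}

/-- The traceless part `β − (tr β / 2)·1` of a raising block is a raising block (given the raising block `1`). [folklore] -/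
private theorem UnitaryThetaTwoTwo.raise_traceless_mem (h1 : Matrix.fromBlocks 0 (1 : Matrix (Fin 2) (Fin 2) ℂ) 0 0 ∈ 𝔐)
    {β : Matrix (Fin 2) (Fin 2) ℂ} (hβ : Matrix.fromBlocks 0 β 0 0 ∈ 𝔐) :
    Matrix.fromBlocks 0 (β - ((2 : ℂ)⁻¹ * β.trace) • (1 : Matrix (Fin 2) (Fin 2) ℂ)) 0 0 ∈ 𝔐 ∧
      (β - ((2 : ℂ)⁻¹ * β.trace) • (1 : Matrix (Fin 2) (Fin 2) ℂ)).trace = 0 := by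
  refine ⟨UnitaryThetaTwoTwo.raise_sub_mem hβ (UnitaryThetaTwoTwo.raise_smul_mem _ h1), ?_⟩
  rw [trace_sub, trace_smul, trace_one, Fintype.card_fin, smul_eq_mul]
  push_cast
  ring

/-- In an eigenbasis-free form: if `s` is traceless with eigenvector `k` (`s k = ν k`, `k ≠ 0`) then `det s = −ν²`
and `tr(s²) = 2ν²`. [folklore] -/
private theorem UnitaryThetaTwoTwo.trace_mul_self_of_eigen {s : Matrix (Fin 2) (Fin 2) ℂ} (hs0 : s.trace = 0)
    {ν : ℂ} {k : Fin 2 → ℂ} (hk : k ≠ 0) (hsk : s *ᵥ k = ν • k) : (s * s).trace = 2 * ν ^ 2 := by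
  classical
  have hk' : (s - ν • (1 : Matrix (Fin 2) (Fin 2) ℂ)) *ᵥ k = 0 := by
    rw [sub_mulVec, smul_mulVec, one_mulVec, hsk, sub_self]
  have h0 := Matrix.exists_mulVec_eq_zero_iff.1 ⟨k, hk, hk'⟩
  rw [det_fin_two] at h0
  simp only [Matrix.sub_apply, Matrix.smul_apply, Matrix.one_apply_eq,
    Matrix.one_apply_ne (show (0 : Fin 2) ≠ 1 by decide), Matrix.one_apply_ne (show (1 : Fin 2) ≠ 0 by decide),
    smul_eq_mul, mul_one, mul_zero, sub_zero] at h0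
  rw [trace_fin_two] at hs0
  rw [UnitaryThetaTwoTwo.mul_self_fin_two, trace_sub, trace_smul, trace_smul, trace_one, Fintype.card_fin,
    trace_fin_two, det_fin_two, smul_eq_mul, smul_eq_mul]
  have hs11 : s 1 1 = -s 0 0 := by linear_combination hs0
  rw [hs11] at h0 ⊢
  push_cast
  linear_combination (-2 : ℂ) * h0

/-- **THE MATRIX CORE THEOREM (`Θ`-subalgebra theorem for multiplicities `(2,2)`).** Let `𝔐` be a `ℂ`-subspace of
`(2+2) × (2+2)` block matrices, closed under the commutator, consisting of traceless matrices, containing the lowering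
block `C = fromBlocks 0 0 1 0` and an invertible raising block `fromBlocks 0 β₀ 0 0` (so `Θ = [raise 1, C] ∈ 𝔐`), acting
irreducibly on `ℂ² ⊕ ℂ²`, and preserving no non-zero bilinear form (`Xᵀ G + G X = 0` for all `X ∈ 𝔐` forces `G = 0`).
Then EVERY traceless matrix lies in `𝔐` (`𝔐 = 𝔰𝔩₄`). Proof: the raising blocks form a subspace `S ∋ 1` equal to the
lowering blocks; if `S` is everything, §4; if `S = ℂ1`, the symmetric form `fromBlocks 0 J (−J) 0` is invariant (`𝔰𝔬₄`);
if `S = ℂ1 ⊕ ℂs`, an eigenline of `s` gives a stable plane; if `S = ℂ1 ⊕ ℂs ⊕ ℂt` with `n = [s,t]` (`≠ 0`), then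
either `det n = 0` and `ker n` gives a stable plane, or `det n ≠ 0` and the alternating form `fromBlocks 0 (Jn) (−Jn) 0`
is invariant (`𝔰𝔭₄`) — the Jacobi identity `[M,n] = λn`, `λ·tr(n²) = tr([M,n]n) = 0` controls the twin diagonal part.
In the Hodge application (`W = V_σ` for a weight-one Hodge structure of rank `8` with `End_Hdg = k` of signature
`(2,2)`): `Lie Hg ⊗ ℂ |_W = 𝔰𝔩(W)`, i.e. «`Hg = SU(V,ψ)`». [cite: MoonenZarhin1999LowDim, §2 (2.5) (2)]
[cite: MoonenZarhin1995Duke, main theorem (type IV(1,1), (2,2))] [cite: vanGeemen1994HodgeAV, Thm. 6.11]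
[cite: Ribet1983, Thm. 3] [cite: Gordon1997, Thm. 6.3.3 and pp. 18–19] -/
theorem UnitaryThetaTwoTwo.mem_of_trace_eq_zero (hbr : ∀ X ∈ 𝔐, ∀ Y ∈ 𝔐, X * Y - Y * X ∈ 𝔐)
    (hsl : ∀ X ∈ 𝔐, Matrix.trace X = 0)
    (hC : Matrix.fromBlocks 0 0 (1 : Matrix (Fin 2) (Fin 2) ℂ) 0 ∈ 𝔐)
    (hB : ∃ β₀ : Matrix (Fin 2) (Fin 2) ℂ, β₀.det ≠ 0 ∧ Matrix.fromBlocks 0 β₀ 0 0 ∈ 𝔐)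
    (hirr : ∀ U : Submodule ℂ (Fin 2 ⊕ Fin 2 → ℂ), (∀ X ∈ 𝔐, ∀ v ∈ U, X *ᵥ v ∈ U) → U = ⊥ ∨ U = ⊤)
    (hND : ∀ G : Matrix (Fin 2 ⊕ Fin 2) (Fin 2 ⊕ Fin 2) ℂ, (∀ X ∈ 𝔐, Xᵀ * G + G * X = 0) → G = 0)
    {Y : Matrix (Fin 2 ⊕ Fin 2) (Fin 2 ⊕ Fin 2) ℂ} (hY : Y.trace = 0) : Y ∈ 𝔐 := by
  classical
  obtain ⟨β₀, hdet, hβ₀⟩ := hB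
  have h1 := UnitaryThetaTwoTwo.raise_one_mem hbr hC hβ₀ hdet
  by_cases hall : ∀ β : Matrix (Fin 2) (Fin 2) ℂ, Matrix.fromBlocks 0 β 0 0 ∈ 𝔐
  · exact UnitaryThetaTwoTwo.mem_of_raise_top hbr hC hall hY
  exfalso
  push Not at hall
  obtain ⟨β₁, hβ₁⟩ := hall
  have htwin : ∀ M : Matrix (Fin 2) (Fin 2) ℂ, Matrix.fromBlocks M 0 0 M ∈ 𝔐 →
      M.trace = 0 ∧ ∀ β : Matrix (Fin 2) (Fin 2) ℂ, Matrix.fromBlocks 0 β 0 0 ∈ 𝔐 →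
        Matrix.fromBlocks 0 (M * β - β * M) 0 0 ∈ 𝔐 :=
    fun M hM => ⟨UnitaryThetaTwoTwo.trace_eq_zero_of_twin hsl hM, fun β hβ => UnitaryThetaTwoTwo.raise_comm_mem hbr hM hβ⟩
  -- Case A (`𝔰𝔬₄`): every raising block is scalar
  by_cases hA : ∀ β : Matrix (Fin 2) (Fin 2) ℂ, Matrix.fromBlocks 0 β 0 0 ∈ 𝔐 →
      ∃ c : ℂ, β = c • (1 : Matrix (Fin 2) (Fin 2) ℂ)
  · have hJ := UnitaryThetaTwoTwo.form_eq_zero hbr h1 hC hND (Γ := !![(0 : ℂ), 1; -1, 0])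
      (fun β hβ => by
        obtain ⟨c, rfl⟩ := hA β hβ
        rw [transpose_smul, transpose_one, Matrix.smul_mul, Matrix.one_mul, Matrix.mul_smul, Matrix.mul_one])
      (fun M hM => by rw [UnitaryThetaTwoTwo.transpose_mul_J_add, (htwin M hM).1, zero_smul])
    have h01 := congr_fun (congr_fun hJ 0) 1
    simp at h01
  push Not at hA
  obtain ⟨β, hβ, hβns⟩ := hA
  obtain ⟨hs, hs0⟩ := UnitaryThetaTwoTwo.raise_traceless_mem h1 hβ
  set s := β - ((2 : ℂ)⁻¹ * β.trace) • (1 : Matrix (Fin 2) (Fin 2) ℂ) with hsdef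
  have hsne : s ≠ 0 := fun h => hβns ((2 : ℂ)⁻¹ * β.trace) (by rwa [hsdef, sub_eq_zero] at h)
  -- Case B1: every raising block lies in `ℂ1 ⊕ ℂs` — an eigenline of `s` gives a stable plane
  by_cases hB1 : ∀ β' : Matrix (Fin 2) (Fin 2) ℂ, Matrix.fromBlocks 0 β' 0 0 ∈ 𝔐 →
      ∃ a b : ℂ, β' = a • (1 : Matrix (Fin 2) (Fin 2) ℂ) + b • s
  · obtain ⟨ν, k, hk, hsk⟩ := UnitaryThetaTwoTwo.exists_eigenvector_fin_two s
    refine UnitaryThetaTwoTwo.not_irreducible_of_eigenline hbr h1 hC hk ?_ ?_ hirr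
    · intro β' hβ'
      obtain ⟨a, b, rfl⟩ := hB1 β' hβ'
      exact ⟨a + b * ν, by rw [add_mulVec, smul_mulVec, smul_mulVec, one_mulVec, hsk, smul_smul, ← add_smul]⟩
    · intro M hM
      obtain ⟨hM0, hMc⟩ := htwin M hM
      obtain ⟨a, b, hab⟩ := hB1 _ (hMc s hs)
      -- `a = 0` (trace of `[M,s]`), `b·tr(s²) = 0` (trace of `[M,s]s`), `tr(s²) = 2ν²`
      have ha : a = 0 := by
        have h := congr_arg Matrix.trace hab
        rw [trace_sub, trace_mul_comm, sub_self, trace_add, trace_smul, trace_smul, hs0, smul_zero, add_zero,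
          trace_one, Fintype.card_fin, smul_eq_mul] at h
        have h' : a * 2 = 0 := by exact_mod_cast h.symm
        exact (mul_eq_zero.1 h').resolve_right two_ne_zero
      have hb : b * ν = 0 := by
        have h := UnitaryThetaTwoTwo.trace_comm_mul_self M s
        rw [hab, Matrix.add_mul, trace_add, Matrix.smul_mul, Matrix.smul_mul, Matrix.one_mul, trace_smul, trace_smul,
          hs0, smul_zero, zero_add, smul_eq_mul, UnitaryThetaTwoTwo.trace_mul_self_of_eigen hs0 hk hsk] at h
        rcases mul_eq_zero.1 h with hb | hν
        · rw [hb, zero_mul]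
        · have : ν = 0 := by simpa using hν
          rw [this, mul_zero]
      have hsν : s ≠ ν • (1 : Matrix (Fin 2) (Fin 2) ℂ) := by
        intro h
        have ht := congr_arg Matrix.trace h
        rw [hs0, trace_smul, trace_one, Fintype.card_fin, smul_eq_mul] at ht
        have hν : ν = 0 := by
          have h2 : ν * 2 = 0 := by exact_mod_cast ht.symm
          exact (mul_eq_zero.1 h2).resolve_right two_ne_zero
        rw [hν, zero_smul] at h
        exact hsne h
      refine UnitaryThetaTwoTwo.exists_smul_of_eigen hk hsk hsν ?_
      have hsM : s * M = M * s - (a • (1 : Matrix (Fin 2) (Fin 2) ℂ) + b • s) := by rw [← hab]; abel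
      rw [sub_mulVec, smul_mulVec, one_mulVec, mulVec_mulVec, hsM, sub_mulVec, add_mulVec, smul_mulVec, smul_mulVec,
        one_mulVec, ← mulVec_mulVec, hsk, mulVec_smul, smul_smul, ha, zero_smul, zero_add, hb, zero_smul, sub_zero,
        sub_self]
  -- Case B2: a second traceless raising block `t ∉ ℂs`; `S = ℂ1 ⊕ ℂs ⊕ ℂt`
  push Not at hB1
  obtain ⟨β', hβ', hβ'ns⟩ := hB1
  obtain ⟨ht, ht0⟩ := UnitaryThetaTwoTwo.raise_traceless_mem h1 hβ'
  set t := β' - ((2 : ℂ)⁻¹ * β'.trace) • (1 : Matrix (Fin 2) (Fin 2) ℂ) with htdef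
  have htns : ∀ c : ℂ, t ≠ c • s := fun c h =>
    hβ'ns ((2 : ℂ)⁻¹ * β'.trace) c (by rw [← h, htdef]; abel)
  set n := s * t - t * s with hndef
  have hn0 : n ≠ 0 := fun h => by
    obtain ⟨c, hc⟩ := UnitaryThetaTwoTwo.exists_smul_of_commute hsne hs0 ht0 (sub_eq_zero.1 h)
    exact htns c hc
  have hn_tr : n.trace = 0 := by rw [hndef, trace_sub, trace_mul_comm, sub_self]
  obtain ⟨hsn, htn⟩ := UnitaryThetaTwoTwo.trace_mul_comm_left s t
  -- the subspace `S` of raising blocks is `span{1, s, t}` (it is proper: `β₁ ∉ S`)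
  let S : Submodule ℂ (Matrix (Fin 2) (Fin 2) ℂ) :=
    { carrier := {β'' | Matrix.fromBlocks 0 β'' 0 0 ∈ 𝔐}
      add_mem' := fun ha hb => UnitaryThetaTwoTwo.raise_add_mem ha hb
      zero_mem' := by
        show Matrix.fromBlocks 0 (0 : Matrix (Fin 2) (Fin 2) ℂ) 0 0 ∈ 𝔐
        rw [fromBlocks_zero]; exact 𝔐.zero_mem
      smul_mem' := fun c β'' hβ'' => UnitaryThetaTwoTwo.raise_smul_mem c hβ'' }
  have hSmem : ∀ β'' : Matrix (Fin 2) (Fin 2) ℂ, β'' ∈ S ↔ Matrix.fromBlocks 0 β'' 0 0 ∈ 𝔐 := fun _ => Iff.rfl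
  have hSlt : S < ⊤ := lt_top_iff_ne_top.2 fun h => hβ₁ ((hSmem β₁).1 (h ▸ Submodule.mem_top))
  have hfin : Module.finrank ℂ S < 4 := by
    have h := Submodule.finrank_lt_finrank_of_lt hSlt
    rw [finrank_top, Module.finrank_matrix, Fintype.card_fin, Module.finrank_self] at h
    simpa using h
  have hli : LinearIndependent ℂ ![(1 : Matrix (Fin 2) (Fin 2) ℂ), s, t] := by
    rw [show ![(1 : Matrix (Fin 2) (Fin 2) ℂ), s, t] = Fin.cons 1 ![s, t] from rfl, linearIndependent_finCons]
    refine ⟨(LinearIndependent.pair_iff' hsne).2 fun c hc => htns c hc.symm, fun hmem => ?_⟩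
    have htr : ∀ x ∈ Submodule.span ℂ (Set.range ![s, t]), Matrix.trace x = 0 := by
      intro x hx
      rw [Submodule.mem_span_range_iff_exists_fun] at hx
      obtain ⟨c, rfl⟩ := hx
      rw [Fin.sum_univ_two, trace_add, trace_smul, trace_smul]
      simp [hs0, ht0]
    have h := htr _ hmem
    rw [trace_one, Fintype.card_fin] at h
    norm_num at h
  have hspan_le : Submodule.span ℂ (Set.range ![(1 : Matrix (Fin 2) (Fin 2) ℂ), s, t]) ≤ S := by
    rw [Submodule.span_le]
    rintro _ ⟨i, rfl⟩
    fin_cases i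
    · exact h1
    · exact hs
    · exact ht
  have hSeq : Submodule.span ℂ (Set.range ![(1 : Matrix (Fin 2) (Fin 2) ℂ), s, t]) = S := by
    apply Submodule.eq_of_le_of_finrank_eq hspan_le
    have h3 := finrank_span_eq_card hli
    rw [Fintype.card_fin] at h3
    have hmono := Submodule.finrank_mono hspan_le
    omega
  have hS3 : ∀ β'' : Matrix (Fin 2) (Fin 2) ℂ, Matrix.fromBlocks 0 β'' 0 0 ∈ 𝔐 →
      ∃ a b c : ℂ, β'' = a • (1 : Matrix (Fin 2) (Fin 2) ℂ) + b • s + c • t := by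
    intro β'' hβ''
    have hmem : β'' ∈ Submodule.span ℂ (Set.range ![(1 : Matrix (Fin 2) (Fin 2) ℂ), s, t]) := by
      rw [hSeq]; exact hβ''
    rw [Submodule.mem_span_range_iff_exists_fun] at hmem
    obtain ⟨c, hc⟩ := hmem
    refine ⟨c 0, c 1, c 2, ?_⟩
    rw [← hc, Fin.sum_univ_three]
    rfl
  -- twins: `[M, n] = λ n` with `λ·tr(n²) = 0`
  have htwin' : ∀ M : Matrix (Fin 2) (Fin 2) ℂ, Matrix.fromBlocks M 0 0 M ∈ 𝔐 →
      ∃ l : ℂ, M * n - n * M = l • n ∧ l * (n * n).trace = 0 := by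
    intro M hM
    obtain ⟨-, hMc⟩ := htwin M hM
    obtain ⟨a, b, c, habc⟩ := hS3 _ (hMc s hs)
    obtain ⟨a', b', c', habc'⟩ := hS3 _ (hMc t ht)
    refine ⟨b + c', UnitaryThetaTwoTwo.comm_bracket_eq_smul habc habc', ?_⟩
    have h := UnitaryThetaTwoTwo.trace_comm_mul_self M n
    rwa [UnitaryThetaTwoTwo.comm_bracket_eq_smul habc habc', Matrix.smul_mul, trace_smul, smul_eq_mul] at h
  by_cases hnd : n.det = 0
  · -- Case B2a: `n` nilpotent — `ker n` gives a stable plane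
    obtain ⟨k, hk, hnk⟩ := Matrix.exists_mulVec_eq_zero_iff.2 hnd
    have hline : ∀ x : Matrix (Fin 2) (Fin 2) ℂ, x.trace = 0 → (x * n).trace = 0 → ∃ c : ℂ, x *ᵥ k = c • k := by
      intro x hx hxn
      have e : x * n + n * x = 0 := by
        rw [UnitaryThetaTwoTwo.mul_add_mul_of_trace_eq_zero hx hn_tr, hxn, zero_smul]
      have h : n *ᵥ (x *ᵥ k) = 0 := by
        rw [mulVec_mulVec, show n * x = -(x * n) from eq_neg_of_add_eq_zero_right e, neg_mulVec, ← mulVec_mulVec,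
          hnk, mulVec_zero, neg_zero]
      exact UnitaryThetaTwoTwo.exists_smul_of_mulVec_eq_zero hn0 hk hnk h
    refine UnitaryThetaTwoTwo.not_irreducible_of_eigenline hbr h1 hC hk ?_ ?_ hirr
    · intro β'' hβ''
      obtain ⟨a, b, c, rfl⟩ := hS3 β'' hβ''
      obtain ⟨cs, hcs⟩ := hline s hs0 hsn
      obtain ⟨ct, hct⟩ := hline t ht0 htn
      exact ⟨a + b * cs + c * ct, by
        rw [add_mulVec, add_mulVec, smul_mulVec, smul_mulVec, smul_mulVec, one_mulVec, hcs, hct, smul_smul,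
          smul_smul, ← add_smul, ← add_smul]⟩
    · intro M hM
      obtain ⟨l, hl, -⟩ := htwin' M hM
      have h : n *ᵥ (M *ᵥ k) = 0 := by
        rw [mulVec_mulVec, show n * M = M * n - l • n by rw [← hl]; abel, sub_mulVec, smul_mulVec, ← mulVec_mulVec,
          hnk, mulVec_zero, smul_zero, sub_zero]
      exact UnitaryThetaTwoTwo.exists_smul_of_mulVec_eq_zero hn0 hk hnk h
  · -- Case B2b: `n` semisimple — the alternating form `fromBlocks 0 (Jn) (−Jn) 0` is invariant (`𝔰𝔭₄`)
    have htr2 : (n * n).trace ≠ 0 := by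
      rw [UnitaryThetaTwoTwo.mul_self_fin_two, hn_tr, zero_smul, zero_sub, trace_neg, trace_smul, trace_one,
        Fintype.card_fin, smul_eq_mul]
      push_cast
      intro h
      apply hnd
      linear_combination (-(2 : ℂ)⁻¹) * h
    have key : ∀ x : Matrix (Fin 2) (Fin 2) ℂ, x.trace = 0 → (x * n).trace = 0 →
        xᵀ * (!![(0 : ℂ), 1; -1, 0] * n) = !![(0 : ℂ), 1; -1, 0] * n * x := by
      intro x hx hxn
      have e : x * n + n * x = 0 := by
        rw [UnitaryThetaTwoTwo.mul_add_mul_of_trace_eq_zero hx hn_tr, hxn, zero_smul]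
      rw [← Matrix.mul_assoc, UnitaryThetaTwoTwo.transpose_mul_J_of_trace_eq_zero hx, Matrix.neg_mul,
        Matrix.mul_assoc, Matrix.mul_assoc, show n * x = -(x * n) from eq_neg_of_add_eq_zero_right e, Matrix.mul_neg]
    have hΓ := UnitaryThetaTwoTwo.form_eq_zero hbr h1 hC hND (Γ := !![(0 : ℂ), 1; -1, 0] * n)
      (fun β'' hβ'' => by
        obtain ⟨a, b, c, rfl⟩ := hS3 β'' hβ''
        rw [transpose_add, transpose_add, transpose_smul, transpose_smul, transpose_smul, transpose_one,
          Matrix.add_mul, Matrix.add_mul, Matrix.smul_mul, Matrix.smul_mul, Matrix.smul_mul, Matrix.one_mul,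
          Matrix.mul_add, Matrix.mul_add, Matrix.mul_smul, Matrix.mul_smul, Matrix.mul_smul, Matrix.mul_one,
          key s hs0 hsn, key t ht0 htn])
      (fun M hM => by
        obtain ⟨hM0, -⟩ := htwin M hM
        obtain ⟨l, hl, hltr⟩ := htwin' M hM
        have hl0 : l = 0 := (mul_eq_zero.1 hltr).resolve_right htr2
        rw [hl0, zero_smul, sub_eq_zero] at hl
        rw [← Matrix.mul_assoc, UnitaryThetaTwoTwo.transpose_mul_J_of_trace_eq_zero hM0, Matrix.neg_mul,
          Matrix.mul_assoc, hl, ← Matrix.mul_assoc, neg_add_cancel])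
    exact UnitaryThetaTwoTwo.J_mul_ne_zero hn0 hΓ

end Main

end HodgeStructure

end Literature.AlgebraicGeometry.Motives

end
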